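import Summits.BirchSwinnertonDyer.BirchSwinnertonDyer.Theorems.ByReductionTypeAtTwoMultTowerNS2LayerZeroLowerPrelim
import Summits.BirchSwinnertonDyer.BirchSwinnertonDyer.Theorems.ByReductionTypeAtTwoMultTowerNS2LayerZeroRelNorm
import Summits.BirchSwinnertonDyer.BirchSwinnertonDyer.Theorems.ByReductionTypeAtTwoMultTowerNS2LayerZeroOddUpper
import Summits.BirchSwinnertonDyer.BirchSwinnertonDyer.Theorems.ByReductionTypeAtTwoEulerCharCoinvExact
import Literature.NumberTheory.EllipticCurves.PAdicBSDSplitMultiplicativeProofs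
import Literature.NumberTheory.EllipticCurves.NonsplitProofs
import Literature.RingTheory.DiscreteValuationRing.AdicCompletionResidueField
import HarnessLib

/-!
# Route `ByReductionTypeAtTwo`, crux `MultUpperHalfAtTwo` (item stmt-BirchSwinnertonDyer-19922), TOWER road, NON-SPLIT rows:
# the layer-`0` order of the local tower kernel at a non-split `2`, part 10 — **`#𝒦_{v,0}[2^∞] = 2·c₂` is a KERNEL
# THEOREM** (the hypothesis `hcount` of `MultEulerChar.twoAdicEulerCharRankZeroNonsplitMult_of_layerZeroCount`)

HONEST FRAMING (cell `bsd-2adic`, run/shared/lean/pub/bsd-2adic/, seat `bsd-2adic-tower-1` GEN 30, HUMAN RULINGS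
D-0036 / D-0054 / D-0074): theorems only (no definition, no named fact, no `sorry`); closes no item by itself; nothing
booked; no display re-keyed (D-0152); BSD is not proved by any of this. R. Greenberg, LNM 1716 (1999), §4 p. 113:
«Assume that E has nonsplit, multiplicative reduction at v. […] If p = 2, then `|ker(r_v)| = 2c_v^{(p)}`.» Over `ℚ`, at the
layer `n = 0` of the cyclotomic `ℤ₂`-tower and the place `v ∋ 2`, this is the count `#𝒦_{v,0}[2^∞] = 2^{ord₂ c₂ + 1}`
(`c₂ = 2` if `ord₂ Δ_min` is even, `1` if odd; *ATAEC* IV.9.4 Step 2), the ONE hypothesis `hcount` of GEN 29's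
`MultEulerChar.twoAdicEulerCharRankZeroNonsplitMult_of_layerZeroCount`. Assembly of parts 1–9
(`…MultTowerNS2LayerZero{Flip,FlipOdd,UnitClass,TateVal,OddUpper,RelNormPrelim,RelNorm,CoinvFinite,LowerPrelim}`) with
hNS2 (`MultTowerNS2.finite_and_natCard_localTowerKerPrimary_le_four_nonsplitTwo`, GEN 27):

* `exists_zpow_two_mul_norm` — the layer-`0` class field input «`ℚ_vˣ = 2^ℤ · N(ℚ_v(t)ˣ)`» (value group of `ℚ_v(t)` +
  part 2 `exists_norm_eq_of_unit`);
* `two_le_and_four_le_natCard_localTowerKerPrimary_zero_nonsplitTwo` — **LOWER bounds**: `2 ≤ #𝒦_{v,0}[2^∞]` always and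
  `4 ≤ #𝒦_{v,0}[2^∞]` when `ord_v Δ_min` is even: `x₁` of exponent `1` (part 2 / part 1), `u = x₁/τ₀x₁ ∈ ℚ_v(t)` of norm
  `1` is a relative norm `∏_{i<4} gⁱf` from `F'_2` (part 7), the witness `y = x₁τ₀f/f` (part 9), the count on the finite
  `2`-primary component of the coinvariants (parts 8–9), moved to `𝒦_{v,0}[2^∞]` by
  `GoodOrdTower.natCard_localTowerKerPrimary_eq_coinv_atP`;
* `natCard_localTowerKerPrimary_zero_eq_nonsplitTwo` — **`#𝒦_{v,0}[2^∞] = 2^{ord₂ c_v + 1}`** (with hNS2's `≤ 4`, part 5's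
  `≤ 2`, and `localTamagawaNumber_of_hasNonsplitMultiplicativeReductionAt_holds`) — verbatim the hypothesis `hcount` of
  GEN 29's `MultEulerChar.twoAdicEulerCharRankZeroNonsplitMult_of_layerZeroCount`; the display
  `X5.O1.TwoAdicEulerCharRankZeroNonsplitMult W 0` on {`E(ℚ)[2] = 0`} follows in part 11 (`…LayerZeroEulerChar.lean`).

References: R. Greenberg, LNM 1716 (1999), §3 pp. 85–93, §4 pp. 102–113; J. Silverman, GTM 151, IV.9.4, V.3–V.5;
J. Neukirch, *ANT* IV (3.5), V §1 (1.1)–(1.2); L. Washington, *Cyclotomic Fields*, §13.1.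
-/

set_option autoImplicit false
-- the Theorems namespace of this sub repeats the summit name by design (D-0017 nested layout: Summit.<S>.<Sub>)
set_option linter.dupNamespace false

noncomputable section

open scoped Classical IntermediateField NNReal

namespace Summit.BirchSwinnertonDyer.BirchSwinnertonDyer.Theorems.MultTowerNS2LayerZero

open NumberField IsDedekindDomain Field WeierstrassCurve PadicInt Rat.HeightOneSpectrum
  Literature.NumberTheory.EllipticCurves Literature.NumberTheory.EllipticCurves.ResKernel
  Literature.NumberTheory.GaloisRepresentations
  Summit.BirchSwinnertonDyer.BirchSwinnertonDyer.Theorems.MultTowerNS2 IsDedekindDomain.HeightOneSpectrum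

variable {κ : ZpExtension ℚ 2}

/-! ### The layer-`0` class field input `ℚ_vˣ = 2^ℤ · N(ℚ_v(t)ˣ)` -/

/-- **`ℚ_vˣ = 2^ℤ · N(ℚ_v(t)ˣ)`**: at a multiplicative `2`, every `x ∈ ℚ_vˣ` is `2^k·f₀·τ₀f₀` with `f₀ ≠ 0` fixed by
`Stab(t)` (`t² = γ(W)`): `|x|_v = |2|_v^k` (value group, part 2 `exists_spectralValuation_eq_zpow_of_stabilizer`) and the unit
`x/2^k` is a norm from `ℚ_v(t)` (part 2 `exists_norm_eq_of_unit`). [cite: NeukirchANT1999, Ch. V §1 Thm. (1.1), Ch. II (7.5)] -/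
theorem exists_zpow_two_mul_norm (W : WeierstrassCurve ℚ) [W.IsElliptic] [W.IsGloballyMinimal]
    (hmult : W.HasMultiplicativeReductionAtPrime 2) (hκ : κ.IsCyclotomic) (v : HeightOneSpectrum (𝓞 ℚ))
    (hv : ((2 : ℕ) : 𝓞 ℚ) ∈ v.asIdeal) {t : AlgebraicClosure (v.adicCompletion ℚ)}
    (ht2 : t ^ 2 = algebraMap (v.adicCompletion ℚ) (AlgebraicClosure (v.adicCompletion ℚ))
      (algebraMap ℚ (v.adicCompletion ℚ) (-(W.c₄ / W.c₆))))
    (ht : ∀ σ : absoluteGaloisGroup (v.adicCompletion ℚ), σ • t = t ∨ σ • t = -t) (ht0 : t ≠ 0)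
    {τ₀ : absoluteGaloisGroup (v.adicCompletion ℚ)} (hτ₀t : τ₀ • t = -t)
    {w : Valuation (AlgebraicClosure (v.adicCompletion ℚ)) ℝ≥0}
    (hw : ∀ x, (w x : ℝ) = spectralNorm (v.adicCompletion ℚ) (AlgebraicClosure (v.adicCompletion ℚ)) x)
    (x : (v.adicCompletion ℚ)ˣ) :
    ∃ (k : ℤ) (f₀ : AlgebraicClosure (v.adicCompletion ℚ)), f₀ ≠ 0 ∧
      (∀ σ : absoluteGaloisGroup (v.adicCompletion ℚ), σ • t = t → σ • f₀ = f₀) ∧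
      algebraMap (v.adicCompletion ℚ) (AlgebraicClosure (v.adicCompletion ℚ)) (x : v.adicCompletion ℚ) =
        (2 : AlgebraicClosure (v.adicCompletion ℚ)) ^ k * (f₀ * τ₀ • f₀) := by
  have hX0 : algebraMap (v.adicCompletion ℚ) (AlgebraicClosure (v.adicCompletion ℚ)) (x : v.adicCompletion ℚ) ≠ 0 :=
    (map_ne_zero _).mpr x.ne_zero
  have hXfix : ∀ σ : absoluteGaloisGroup (v.adicCompletion ℚ),
      σ • algebraMap (v.adicCompletion ℚ) (AlgebraicClosure (v.adicCompletion ℚ)) (x : v.adicCompletion ℚ) =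
        algebraMap (v.adicCompletion ℚ) (AlgebraicClosure (v.adicCompletion ℚ)) (x : v.adicCompletion ℚ) := fun σ ↦
    AlgEquiv.commutes (absoluteGaloisGroup.toAlgEquiv _ σ) _
  have h20 : (2 : AlgebraicClosure (v.adicCompletion ℚ)) ≠ 0 := by
    haveI : CharZero (AlgebraicClosure (v.adicCompletion ℚ)) :=
      charZero_of_injective_algebraMap (algebraMap ℚ (AlgebraicClosure (v.adicCompletion ℚ))).injective
    exact two_ne_zero
  have h2fix : ∀ σ : absoluteGaloisGroup (v.adicCompletion ℚ), σ • (2 : AlgebraicClosure (v.adicCompletion ℚ)) = 2 :=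
    fun σ ↦ by
      change absoluteGaloisGroup.toAlgEquiv (v.adicCompletion ℚ) σ 2 = 2
      exact map_ofNat _ 2
  have hw20 : w 2 ≠ 0 := (Valuation.ne_zero_iff _).mpr h20
  obtain ⟨k, hk⟩ := exists_spectralValuation_eq_zpow_of_stabilizer W hmult v hv ht2 hw hX0 (fun σ _ ↦ hXfix σ)
  have hcfix : ∀ σ : absoluteGaloisGroup (v.adicCompletion ℚ),
      σ • (algebraMap (v.adicCompletion ℚ) (AlgebraicClosure (v.adicCompletion ℚ)) (x : v.adicCompletion ℚ) /
        (2 : AlgebraicClosure (v.adicCompletion ℚ)) ^ k) =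
        algebraMap (v.adicCompletion ℚ) (AlgebraicClosure (v.adicCompletion ℚ)) (x : v.adicCompletion ℚ) /
          (2 : AlgebraicClosure (v.adicCompletion ℚ)) ^ k := fun σ ↦ by
    rw [smul_div₀', hXfix, smul_zpow₀', h2fix]
  have hc1 : w (algebraMap (v.adicCompletion ℚ) (AlgebraicClosure (v.adicCompletion ℚ)) (x : v.adicCompletion ℚ) /
      (2 : AlgebraicClosure (v.adicCompletion ℚ)) ^ k) = 1 := by
    rw [map_div₀, map_zpow₀, hk, div_self (zpow_ne_zero _ hw20)]
  obtain ⟨f₀, hf₀0, hf₀S, hcf⟩ := exists_norm_eq_of_unit W hmult hκ v hv ht2 ht ht0 hτ₀t hw hcfix hc1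
  refine ⟨k, f₀, hf₀0, hf₀S, ?_⟩
  rw [← hcf, mul_div_cancel₀ _ (zpow_ne_zero _ h20)]

/-! ### The lower bounds `2 ≤ #𝒦_{v,0}[2^∞]`, and `4 ≤ #𝒦_{v,0}[2^∞]` when `ord_v Δ_min` is even -/

/-- **LOWER bounds for the layer-`0` local tower kernel at a NON-SPLIT multiplicative `2` — KERNEL theorem.** For a globally
minimal `W/ℚ`, multiplicative and NON-SPLIT at `2`, every cyclotomic `κ` and the place `v ∋ 2`: `2 ≤ #𝒦_{v,0}[2^∞]`, and
`4 ≤ #𝒦_{v,0}[2^∞]` if `ord_v(Δ_min)` is even. Proof: an element `x₁` of the twisted Tate module of exponent `1`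
(`τ₀x₁·x₁ = q_E`; parts 1–2); `u = x₁/τ₀x₁ ∈ ℚ_v(t)` has norm `1`, hence is a relative norm `∏_{i<4} gⁱf` from the second
layer `K̄^{H_2 ∩ Stab t}` (part 7); `y = x₁·τ₀f/f` is an ODD-exponent class with `y⁴ ∈ B` (part 9), so `[Ψy] ≠ 0`; when
`ord_v Δ_min` is even, `[Ψ(−1)] ≠ 0` too (part 1) and `0, [Ψ(−1)], [Ψy], [Ψ(−y)]` are distinct; the `2`-primary component of
the coinvariants is finite (part 8) and counts `𝒦_{v,0}[2^∞]` exactly (`GoodOrdTower.natCard_localTowerKerPrimary_eq_coinv_atP`).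
[cite: GreenbergLNM1716, §3 p. 93 and §4 p. 113] [cite: SilvermanATAEC1994, Thm. V.5.3, Lemma V.5.2] -/
theorem two_le_and_four_le_natCard_localTowerKerPrimary_zero_nonsplitTwo (W : WeierstrassCurve ℚ) [W.IsElliptic]
    [W.IsGloballyMinimal] (hmult : W.HasMultiplicativeReductionAtPrime 2)
    (hns : ¬ W.HasSplitMultiplicativeReductionAtPrime 2) (hκ : κ.IsCyclotomic) (v : HeightOneSpectrum (𝓞 ℚ))
    (hv : ((2 : ℕ) : 𝓞 ℚ) ∈ v.asIdeal) :
    2 ≤ Nat.card (W.localTowerKerPrimary κ (v.adicCompletion ℚ) 0) ∧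
      (Even (W.ordMinimalDiscriminant v) → 4 ≤ Nat.card (W.localTowerKerPrimary κ (v.adicCompletion ℚ) 0)) := by
  -- S0: multiplicative reduction at the place `v`
  haveI hfact : Fact (Nat.Prime (primesEquiv v : ℕ)) := ⟨(primesEquiv v).2⟩
  have hp2 : ((primesEquiv v : Nat.Primes) : ℕ) = 2 := primesEquiv_eq_of_natCast_mem v Nat.prime_two hv
  have hmultv : W.HasMultiplicativeReductionAt v :=
    (hasMultiplicativeReductionAtPrime_iff_hasMultiplicativeReductionAt_ringOfIntegers (W := W) v).mp
      ((KatoHalfPinch.hasMultiplicativeReductionAtPrime_congr W hp2).mpr hmult)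
  -- normality of the local subgroups, `H_∞ ≤ H_2`, `H_∞ ≤ H_0`
  haveI hNi : (localSubgroup κ.kerSubgroup (v.adicCompletion ℚ)).Normal := by
    rw [localSubgroup_eq_comap]; exact Subgroup.Normal.comap inferInstance _
  haveI hN2 : (localSubgroup (κ.layerSubgroup 2) (v.adicCompletion ℚ)).Normal := by
    rw [localSubgroup_eq_comap]; exact Subgroup.Normal.comap inferInstance _
  have hle2 : localSubgroup κ.kerSubgroup (v.adicCompletion ℚ) ≤ localSubgroup (κ.layerSubgroup 2) (v.adicCompletion ℚ) :=
    fun τ hτ ↦ by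
      rw [mem_localSubgroup_iff] at hτ ⊢
      exact κ.kerSubgroup_le_layerSubgroup 2 hτ
  have hile : localSubgroup κ.kerSubgroup (v.adicCompletion ℚ) ≤ localSubgroup (κ.layerSubgroup 0) (v.adicCompletion ℚ) :=
    fun τ hτ ↦ by
      rw [mem_localSubgroup_iff] at hτ ⊢
      exact κ.kerSubgroup_le_layerSubgroup 0 hτ
  -- Tate's twisted uniformisation at `v`
  obtain ⟨q, t, Ψ, hq0, hqv, hqj, -, ht0, ht2, hsurj, hker, hequiv⟩ :=
    TateCurve.exists_twistedTateUniformisation_tateJ W v hmultv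
  set Q : AlgebraicClosure (v.adicCompletion ℚ) :=
    algebraMap (v.adicCompletion ℚ) (AlgebraicClosure (v.adicCompletion ℚ)) q with hQ
  have hQ0 : Q ≠ 0 := by rw [hQ]; exact (map_ne_zero _).mpr hq0
  have hQfix : ∀ σ : absoluteGaloisGroup (v.adicCompletion ℚ), σ • Q = Q := fun σ ↦
    AlgEquiv.commutes (absoluteGaloisGroup.toAlgEquiv _ σ) q
  have hQtor : ∀ j : ℤ, Q ^ j = 1 → j = 0 := by
    intro j hj
    have hj' : q ^ j = 1 := by
      apply (algebraMap (v.adicCompletion ℚ) (AlgebraicClosure (v.adicCompletion ℚ))).injective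
      rw [map_zpow₀, map_one]; exact hj
    have hq1 : ‖q‖ < 1 := Valued.toNormedField.norm_lt_one_iff.mpr hqv
    have hpow : ∀ m : ℕ, q ^ m = 1 → m = 0 := fun m hm ↦ by
      by_contra hm0
      have h1 : ‖q‖ ^ m < 1 := pow_lt_one₀ (norm_nonneg q) hq1 hm0
      rw [← norm_pow, hm, norm_one] at h1
      exact lt_irrefl _ h1
    cases j with
    | ofNat m =>
      rw [Int.ofNat_eq_natCast, zpow_natCast] at hj'
      rw [Int.ofNat_eq_natCast, hpow m hj']
      rfl
    | negSucc m =>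
      rw [zpow_negSucc, inv_eq_one] at hj'
      exact absurd (hpow (m + 1) hj') (Nat.succ_ne_zero m)
  -- the spectral valuation, `|Q|_v = |2|_v^m`
  obtain ⟨w, hw⟩ := v.exists_spectralValuation
  have hQm : w Q = w 2 ^ (W.ordMinimalDiscriminant v) :=
    spectralValuation_tateParameter_eq_pow_ordMinimalDiscriminant W hmult v hv hqj hw
  have h20 : (2 : AlgebraicClosure (v.adicCompletion ℚ)) ≠ 0 := by
    haveI : CharZero (AlgebraicClosure (v.adicCompletion ℚ)) :=
      charZero_of_injective_algebraMap (algebraMap ℚ (AlgebraicClosure (v.adicCompletion ℚ))).injective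
    exact two_ne_zero
  have h2fix : ∀ σ : absoluteGaloisGroup (v.adicCompletion ℚ), σ • (2 : AlgebraicClosure (v.adicCompletion ℚ)) = 2 :=
    fun σ ↦ by
      change absoluteGaloisGroup.toAlgEquiv (v.adicCompletion ℚ) σ 2 = 2
      exact map_ofNat _ 2
  have hw20 : w 2 ≠ 0 := (Valuation.ne_zero_iff _).mpr h20
  -- `σ t = ± t`, `-t ≠ t`, equivariance in value form
  have ht : ∀ σ : absoluteGaloisGroup (v.adicCompletion ℚ), σ • t = t ∨ σ • t = -t := fun σ ↦ by
    apply sq_eq_sq_iff_eq_or_eq_neg.mp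
    rw [← smul_pow', ht2]
    exact AlgEquiv.commutes (absoluteGaloisGroup.toAlgEquiv _ σ) _
  have hne : -t ≠ t := neg_ne_self_of_ne_zero v ht0
  have hequiv' : ∀ (σ : absoluteGaloisGroup (v.adicCompletion ℚ)) (w w' : (AlgebraicClosure (v.adicCompletion ℚ))ˣ),
      (w' : AlgebraicClosure (v.adicCompletion ℚ)) = σ • (w : AlgebraicClosure (v.adicCompletion ℚ)) →
        σ • Ψ (Additive.ofMul w) = (if σ • t = t then (1 : ℤ) else -1) • Ψ (Additive.ofMul w') := by
    intro σ w w' h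
    have hw' : w' = Units.map (absoluteGaloisGroup.toAlgEquiv (v.adicCompletion ℚ) σ :
        AlgebraicClosure (v.adicCompletion ℚ) →* AlgebraicClosure (v.adicCompletion ℚ)) w := Units.ext h
    rw [hw']
    exact hequiv σ w
  -- the flip `τ₀ ∈ H_∞` (BRICK 10) and a generator `g` at the layer `0` fixing `t`
  obtain ⟨τ₀, hτ₀, hτ₀t⟩ :=
    exists_mem_localSubgroup_kerSubgroup_smul_sqrt_gamma_eq_neg W hκ hmult hns v hv t ht2
  obtain ⟨g, hgn, hgen, hgt⟩ : ∃ g ∈ localSubgroup (κ.layerSubgroup 0) (v.adicCompletion ℚ),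
      (∀ U : Subgroup (absoluteGaloisGroup (v.adicCompletion ℚ)),
        IsOpen (U : Set (absoluteGaloisGroup (v.adicCompletion ℚ))) →
          localSubgroup κ.kerSubgroup (v.adicCompletion ℚ) ≤ U → g ∈ U →
            localSubgroup (κ.layerSubgroup 0) (v.adicCompletion ℚ) ≤ U) ∧ g • t = t := by
    obtain ⟨g₀, hg₀, hg₀gen⟩ := ZpExtension.exists_mem_localSubgroup_generate κ (v.adicCompletion ℚ) 0
    rcases ht g₀ with h | h
    · exact ⟨g₀, hg₀, hg₀gen, h⟩
    · refine ⟨g₀ * τ₀, Subgroup.mul_mem _ hg₀ (hile hτ₀), fun U hU hiU hgU ↦ hg₀gen U hU hiU ?_, ?_⟩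
      · have h1 := U.mul_mem hgU (U.inv_mem (hiU hτ₀))
        rwa [mul_inv_cancel_right] at h1
      · rw [mul_smul, hτ₀t, smul_neg, h, neg_neg]
  obtain ⟨ug, hug⟩ := exists_units_kappa_resGal_eq_of_generate hκ v hv 0 hgn hgen
  have hgpt : ∀ i : ℕ, (g ^ i) • t = t := fun i ↦ by
    induction i with
    | zero => rw [pow_zero, one_smul]
    | succ i ih => rw [pow_succ, mul_smul, hgt, ih]
  -- the quadratic class field input at the layer `0` (BRICK 17)
  have hN2cf := fun (c₁ c₂ c₃ : AlgebraicClosure (v.adicCompletion ℚ)) (h1 : c₁ ≠ 0) (h2 : c₂ ≠ 0) (h3 : c₃ ≠ 0)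
      (hc₁ : ∀ h ∈ localSubgroup (κ.layerSubgroup 0) (v.adicCompletion ℚ), h • c₁ = c₁)
      (hc₂ : ∀ h ∈ localSubgroup (κ.layerSubgroup 0) (v.adicCompletion ℚ), h • c₂ = c₂)
      (hc₃ : ∀ h ∈ localSubgroup (κ.layerSubgroup 0) (v.adicCompletion ℚ), h • c₃ = c₃) ↦
    exists_norm_rel_of_three hκ v hv 0 ht ht0 (hile hτ₀) hτ₀t c₁ c₂ c₃ h1 h2 h3 hc₁ hc₂ hc₃
  -- `x₁` of exponent one, with `g x₁ = ± x₁`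
  obtain ⟨x₁, hx0, hxL, hxQ, hgx⟩ : ∃ x₁ : AlgebraicClosure (v.adicCompletion ℚ), x₁ ≠ 0 ∧
      (∀ h ∈ localSubgroup κ.kerSubgroup (v.adicCompletion ℚ), h • t = t → h • x₁ = x₁) ∧
      τ₀ • x₁ * x₁ = Q ∧ (g • x₁ = x₁ ∨ g • x₁ = -x₁) := by
    rcases Nat.even_or_odd (W.ordMinimalDiscriminant v) with hev | hodd
    · obtain ⟨h', hh'⟩ := hev
      have hcfix : ∀ σ : absoluteGaloisGroup (v.adicCompletion ℚ),
          σ • (Q / (2 : AlgebraicClosure (v.adicCompletion ℚ)) ^ W.ordMinimalDiscriminant v) =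
            Q / (2 : AlgebraicClosure (v.adicCompletion ℚ)) ^ W.ordMinimalDiscriminant v := fun σ ↦ by
        rw [smul_div₀', hQfix, smul_pow', h2fix]
      have hc1 : w (Q / (2 : AlgebraicClosure (v.adicCompletion ℚ)) ^ W.ordMinimalDiscriminant v) = 1 := by
        rw [map_div₀, map_pow, hQm, div_self (pow_ne_zero _ hw20)]
      obtain ⟨f₀, hf₀0, hf₀S, hcf⟩ := exists_norm_eq_of_unit W hmult hκ v hv ht2 ht ht0 hτ₀t hw hcfix hc1
      refine ⟨2 ^ h' * f₀, mul_ne_zero (pow_ne_zero _ h20) hf₀0,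
        fun h hh hht ↦ by rw [smul_mul', smul_pow', h2fix, hf₀S h hht], ?_,
        Or.inl (by rw [smul_mul', smul_pow', h2fix, hf₀S g hgt])⟩
      calc τ₀ • ((2 : AlgebraicClosure (v.adicCompletion ℚ)) ^ h' * f₀) * (2 ^ h' * f₀)
          = (2 : AlgebraicClosure (v.adicCompletion ℚ)) ^ (h' + h') * (f₀ * τ₀ • f₀) := by
            rw [smul_mul', smul_pow', h2fix, pow_add]; ring
        _ = Q := by rw [← hh', ← hcf, mul_div_cancel₀ _ (pow_ne_zero _ h20)]
    · obtain ⟨x₁, hx0, hxL, hxQ, hgx⟩ :=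
        exists_generator_smul_eq_neg_of_odd W hmult hκ v hv ht2 ht ht0 hτ₀ hτ₀t hug hgt hQfix hw hQm hodd
      exact ⟨x₁, hx0, hxL, hxQ, Or.inr hgx⟩
  -- `u = x₁ / τ₀x₁ ∈ ℚ_v(t)` of norm `1`
  have hX0 : τ₀ • x₁ ≠ 0 := (smul_ne_zero_iff_ne τ₀).mpr hx0
  have hττx : τ₀ • τ₀ • x₁ = x₁ := flip_smul_flip_smul hτ₀ hτ₀t hxL
  have huL : ∀ h ∈ localSubgroup κ.kerSubgroup (v.adicCompletion ℚ), h • t = t →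
      h • (x₁ / τ₀ • x₁) = x₁ / τ₀ • x₁ := fun h hh hht ↦ by
    rw [smul_div₀', hxL h hh hht, ← flip_smul_smul_comm ht hτ₀ hτ₀t hht hxL, hxL h hh hht]
  have hgu : g • (x₁ / τ₀ • x₁) = x₁ / τ₀ • x₁ := by
    rw [smul_div₀', ← flip_smul_smul_comm ht hτ₀ hτ₀t hgt hxL]
    rcases hgx with h | h
    · rw [h]
    · rw [h, smul_neg, neg_div_neg_eq]
  have huS : ∀ σ : absoluteGaloisGroup (v.adicCompletion ℚ), σ • t = t → σ • (x₁ / τ₀ • x₁) = x₁ / τ₀ • x₁ :=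
    fun σ hσ ↦ smul_eq_self_of_stabilizer_of_generator v hug hgt huL hgu hσ
  have hu0 : x₁ / τ₀ • x₁ ≠ 0 := div_ne_zero hx0 hX0
  have huN : x₁ / τ₀ • x₁ * τ₀ • (x₁ / τ₀ • x₁) = 1 := by
    rw [smul_div₀', hττx]
    field_simp
  -- relative norm existence at the second layer (part 7)
  obtain ⟨f, hf0, hfL2, hNf⟩ := exists_prod_smul_eq_of_norm_mem_range_norm_layer hκ v hv (n := 2) (by norm_num) ht ht0
    hτ₀ hτ₀t hug hgt (fun x ↦ exists_zpow_two_mul_norm W hmult hκ v hv ht2 ht ht0 hτ₀t hw x) hu0 huS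
    ⟨1, one_mem _, by rw [Units.val_one, map_one]; exact huN.symm⟩
  have hg4 : (g ^ 4) • f = f := by
    have h := (pow_mem_localSubgroup_layerSubgroup_iff (κ := κ) v 0 2 hug 4).mpr (by norm_num)
    rw [zero_add] at h
    exact hfL2 _ h (hgpt 4)
  -- the witness (part 9)
  obtain ⟨y, z, hy0, hyL, hya, hz0, hzL, hzj, hyk⟩ := exists_pow_four_eq_sq_mul_coboundary v ht hle2 hτ₀ hτ₀t hgt hx0
    hxL hxQ hf0 hfL2 hg4 hNf
  -- the `2`-primary component of the coinvariants is finite (part 8) and counts `𝒦_{v,0}[2^∞]`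
  obtain ⟨hfinP, -⟩ := finite_primaryComponent_coinvariants_and_natCard_le_four (κ := κ) v 0 hug hgn ht hne hgt hτ₀ hτ₀t
    hQfix hQ0 hQtor hN2cf hsurj hker hequiv'
  haveI := hfinP
  have hT := GoodOrdTower.natCard_localTowerKerPrimary_eq_coinv_atP hκ v hv W 0 hgn hgen
  rw [hT]
  refine ⟨two_le_natCard_primaryComponent_of_odd (κ := κ) v hsurj hker hequiv' ht hne hgt hτ₀ hτ₀t hQfix hQ0 hQtor hy0 hyL
    hya odd_one hz0 hzL hzj hyk, fun heven ↦ ?_⟩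
  exact four_le_natCard_primaryComponent_of_odd_of_neg_one (κ := κ) v hsurj hker hequiv' ht hne hgt hτ₀ hτ₀t hQfix hQ0
    hQtor (fun w' aw jw hw0 hwL hwa ↦ neg_one_ne_zpow_mul_coboundary_of_even W hmult hκ v hv ht2 ht hτ₀ hτ₀t hug hgt hQfix
      hQ0 hQtor hw hQm heven hw0 hwL hwa jw) hy0 hyL hya odd_one hz0 hzL hzj hyk

/-! ### The count -/

/-- **`#𝒦_{v,0}[2^∞] = 2^{ord₂ c_v + 1} = 2·c_v` at a NON-SPLIT multiplicative `2` — KERNEL theorem** (Greenberg, LNM 1716,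
§4 p. 113: «If p = 2, then `|ker(r_v)| = 2c_v^{(p)}`»). For a globally minimal `W/ℚ`, multiplicative and non-split at `2`,
every cyclotomic `κ`, the place `v ∋ 2`: `ord_v Δ_min` even — `c_v = 2`, `4 ≤ # ≤ 4` (hNS2); odd — `c_v = 1`,
`2 ≤ # ≤ 2` (part 5). [cite: GreenbergLNM1716, §4 pp. 112–113; §3 p. 93] [cite: SilvermanATAEC1994, IV.9.4 Step 2] -/
theorem natCard_localTowerKerPrimary_zero_eq_nonsplitTwo (W : WeierstrassCurve ℚ) [W.IsElliptic] [W.IsGloballyMinimal]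
    (hmult : W.HasMultiplicativeReductionAtPrime 2) (hns : ¬ W.HasSplitMultiplicativeReductionAtPrime 2)
    (hκ : κ.IsCyclotomic) (v : HeightOneSpectrum (𝓞 ℚ)) (hv : ((2 : ℕ) : 𝓞 ℚ) ∈ v.asIdeal) :
    Nat.card (W.localTowerKerPrimary κ (v.adicCompletion ℚ) 0) =
      2 ^ (padicValNat 2 ((W.baseChange (v.adicCompletion ℚ)).localTamagawaNumber (v.adicCompletionIntegers ℚ)) + 1) := by
  obtain ⟨h2, h4⟩ := two_le_and_four_le_natCard_localTowerKerPrimary_zero_nonsplitTwo W hmult hns hκ v hv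
  -- the Tamagawa number at the place `v`
  haveI hfact : Fact (Nat.Prime (primesEquiv v : ℕ)) := ⟨(primesEquiv v).2⟩
  have hp2 : ((primesEquiv v : Nat.Primes) : ℕ) = 2 := primesEquiv_eq_of_natCast_mem v Nat.prime_two hv
  have hmultv : W.HasMultiplicativeReductionAt v :=
    (hasMultiplicativeReductionAtPrime_iff_hasMultiplicativeReductionAt_ringOfIntegers (W := W) v).mp
      ((KatoHalfPinch.hasMultiplicativeReductionAtPrime_congr W hp2).mpr hmult)
  have hnsv : ¬ W.HasSplitMultiplicativeReductionAt v := by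
    have hvp : primesEquiv v = ⟨2, Nat.prime_two⟩ := Subtype.ext hp2
    have key : ∀ r : Nat.Primes, primesEquiv v = r →
        ((haveI := Fact.mk r.2; W.HasSplitMultiplicativeReductionAtPrime (r : ℕ)) ↔
          W.HasSplitMultiplicativeReductionAt v) := by
      rintro r rfl
      exact hasSplitMultiplicativeReductionAtPrime_iff_hasSplitMultiplicativeReductionAt W v
    rw [← key ⟨2, Nat.prime_two⟩ hvp]
    exact hns
  haveI : Finite (IsLocalRing.ResidueField (v.adicCompletionIntegers ℚ)) :=
    HeightOneSpectrum.finite_residueField_adicCompletionIntegers ℚ v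
  rw [localTamagawaNumber_of_hasNonsplitMultiplicativeReductionAt_holds v W hmultv hnsv]
  rcases Nat.even_or_odd (W.ordMinimalDiscriminant v) with hev | hodd
  · rw [if_pos hev, padicValNat.self (by norm_num)]
    have hle := (finite_and_natCard_localTowerKerPrimary_le_four_nonsplitTwo W hmult hns hκ v hv 0).2
    have hge := h4 hev
    omega
  · rw [if_neg (Nat.not_even_iff_odd.mpr hodd), padicValNat_one_right]
    have hle := (finite_and_natCard_localTowerKerPrimary_zero_le_two_nonsplitTwo_of_odd W hmult hns hκ v hv hodd).2
    omega

end Summit.BirchSwinnertonDyer.BirchSwinnertonDyer.Theorems.MultTowerNS2LayerZero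

end
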